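import Summits.CriticalPhenomena.PercolationContinuityZ3.Theorems.PercAnnulusCrossingNoiseRevealment
import HarnessLib

/-!
# RSW3 lane (lead, gen 20): NOISE SENSITIVITY OF CROSSINGS, IV — the ε-noised configuration, the spectral formula
# `E[f(ω)f(ω^ε)] = Σ_S (1−ε)^{|S|} f̂(S)²`, and NOISE SENSITIVITY FROM SMALL REVEALMENT (abstract)

builds on p205010 (kernel theorem, internal audit signed; external expert review pending) — NOT used in this file (abstract).

Cell `prim-rsw3` (LANE 3), lead seat, gen 20.  Support file (`--supports stmt-CriticalPhenomena-4575`); no definitions, no named facts,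
no sorries.  Setting of parts I–III.  The ε-NOISED copy of `x ~ wt p` is `ω^ε = (fun i => if m i then y i else x i)` with an independent
`y ~ wt p` and an independent mask `m ~ wt (fun _ => ε)` (each coordinate is resampled from its own bias with probability `ε`,
independently); the NOISE CORRELATION of `f` is the finite sum `E[f(ω) f(ω^ε)] = Σ_x Σ_y Σ_m wt p x · wt p y · wt ε̄ m · f(x) f(ω^ε)` (written
out; no definition).  Proved, for `p ∈ [0,1]^ι`:

* §1 `sum_sum_wt_mix_swap` / `sum_sum_wt_mask_swap` — exchanging the coordinates of a set (of a mask) between two independent samples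
  preserves the product law; `sum_wt_char_mask` — `E_y[χ_S(ω^ε)] = 𝟙[m ∩ S = ∅]·χ_S(x)`; `sum_wt_mask_prod` — `E_m Π_{i∈S}(𝟙[¬m_i] c_i) = (1−ε)^{|S|} Π c_i`;
  **`noise_coeff`** — `(T_ε f)^(S) = (1−ε)^{|S|} f̂(S)`; **`noise_correlation_eq_sum_coeff_sq`** — THE SPECTRAL FORMULA
  `E[f(ω)f(ω^ε)] = Σ_S (1−ε)^{|S|} f̂(S)²`; `coeff_empty` — `f̂(∅) = E f`.
* §2 **`noise_correlation_sub_sq_nonneg`**, **`noise_correlation_sub_sq_le`** — `0 ≤ E[f(ω)f(ω^ε)] − (E f)² ≤ L_m + (1−ε)^{m+1}·Var f` where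
  `L_m = Σ_{k=1}^{m} Σ_{|S|=k} f̂(S)²` is the Fourier weight on the levels `1..m` (every `m`).
* §3 **`noise_correlation_sub_sq_le_of_revealment`** — WITH SCHRAMM–STEIF (part III): if `f` is computed by reduced trees `T_t` mixed with weights
  `q_t` and every coordinate is revealed with probability `≤ δ`, then for EVERY `m`:
  **`0 ≤ E_p[f(ω)f(ω^ε)] − E_p[f]² ≤ m²·δ·E_p[f²] + (1−ε)^{m+1}·(E_p[f²] − E_p[f]²)`** — no characters in the statement (the p-biased
  character system of part I is used inside the proof).  With `δ_n → 0` and `m_n → ∞`, `m_n²δ_n → 0`: NOISE SENSITIVITY (Schramm–Steif Cor 1.9 /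
  Garban–Steif Cor VIII.3), quantitatively.

References: I. Benjamini, G. Kalai, O. Schramm, *Noise sensitivity of Boolean functions and applications to percolation*, Publ. Math. IHÉS 90
(1999) 5–43 (definition of noise sensitivity, (1.2)); O. Schramm, J. Steif, Ann. of Math. 171 (2010), Thm 1.8 and §1 (E[f(ω)f(ω_ε)] =
Σ_S f̂(S)²(1−ε)^{|S|}); C. Garban, J. Steif, *Noise sensitivity of Boolean functions and percolation*, CUP 2014, Ch. I Def I.2, Ch. IV (1.3)
(the spectral formula, p-biased case §IV.1), Ch. VIII Prop VIII.3; R. O'Donnell, *Analysis of Boolean Functions*, CUP 2014, §2.4, §8.4.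
-/

noncomputable section

namespace Summit.CriticalPhenomena.PercolationContinuityZ3.Theorems.Crossing.Spectral

open Finset Function
open Literature.Probability.ODonnellSaksSchrammServedio2005

variable {ι : Type*} [Fintype ι] [DecidableEq ι]

/-! ## §1 The noised configuration and the spectral formula -/

/-- **Exchanging the coordinates of a set between two independent samples preserves the product law**:
`E_{x,y} Φ(x, y) = E_{x,y} Φ(x|_{Aᶜ} y|_A, y|_{Aᶜ} x|_A)` (iterate the one-coordinate swap `sum_sum_wt_swap`).
[cite: ODonnell2014, §2.4 Def 2.40 ((ρ-)correlated pairs: resampling a random set of coordinates)] -/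
theorem sum_sum_wt_mix_swap (p : ι → ℝ) (A : Finset ι) (Φ : (ι → Bool) → (ι → Bool) → ℝ) :
    ∑ x : ι → Bool, ∑ y : ι → Bool, wt p x * wt p y * Φ x y
      = ∑ x : ι → Bool, ∑ y : ι → Bool, wt p x * wt p y *
          Φ (fun i => if i ∈ A then y i else x i) (fun i => if i ∈ A then x i else y i) := by
  induction A using Finset.induction_on generalizing Φ with
  | empty => simp
  | @insert a A ha ih =>
    -- swap coordinate `a`, then the set `A`
    rw [sum_sum_wt_swap p a Φ, ih (fun x y => Φ (update x a (y a)) (update y a (x a)))]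
    refine Finset.sum_congr rfl fun x _ => Finset.sum_congr rfl fun y _ => ?_
    have e1 : update (fun i => if i ∈ A then y i else x i) a ((fun i => if i ∈ A then x i else y i) a)
        = (fun i => if i ∈ insert a A then y i else x i) := by
      funext i
      by_cases hia : i = a
      · subst hia; simp [ha]
      · simp [Finset.mem_insert, hia]
    have e2 : update (fun i => if i ∈ A then x i else y i) a ((fun i => if i ∈ A then y i else x i) a)
        = (fun i => if i ∈ insert a A then x i else y i) := by
      funext i
      by_cases hia : i = a
      · subst hia; simp [ha]
      · simp [Finset.mem_insert, hia]
    rw [e1, e2]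

/-- Mask form: for a mask `m : ι → Bool`, `E_{x,y} Φ(x, y) = E_{x,y} Φ(ω^m(x,y), ω^m(y,x))` with `ω^m(x,y) = (y on {m = 1}, x elsewhere)`.
[cite: ODonnell2014, §2.4 Def 2.40 (correlated pairs)] -/
theorem sum_sum_wt_mask_swap (p : ι → ℝ) (m : ι → Bool) (Φ : (ι → Bool) → (ι → Bool) → ℝ) :
    ∑ x : ι → Bool, ∑ y : ι → Bool, wt p x * wt p y * Φ x y
      = ∑ x : ι → Bool, ∑ y : ι → Bool, wt p x * wt p y *
          Φ (fun i => if m i = true then y i else x i) (fun i => if m i = true then x i else y i) := by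
  rw [sum_sum_wt_mix_swap p (Finset.univ.filter fun i => m i = true) Φ]
  refine Finset.sum_congr rfl fun x _ => Finset.sum_congr rfl fun y _ => ?_
  simp only [Finset.mem_filter, Finset.mem_univ, true_and]

/-- **`E_y[χ_S(ω^m(x,y))] = Π_{i∈S} 𝟙[¬m_i]·r_i(x_i)`**: a resampled coordinate of `S` contributes the mean-zero factor `E[r_i] = 0` (H1).
[cite: GarbanSteif2014, Ch. IV §1 (1.3) (T_ε χ_S = (1−ε)^{|S|} χ_S, p-biased case §IV.1)] -/
theorem sum_wt_char_mask {p : ι → ℝ} {r : ι → Bool → ℝ} (hH1 : ∀ i, p i * r i true + (1 - p i) * r i false = 0)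
    (S : Finset ι) (m x : ι → Bool) :
    ∑ y : ι → Bool, wt p y * ∏ i ∈ S, r i (if m i = true then y i else x i)
      = ∏ i ∈ S, (if m i = true then 0 else r i (x i)) := by
  rw [sum_wt_mul_prod_finset p S (fun i b => r i (if m i = true then b else x i))]
  refine Finset.prod_congr rfl fun i _ => ?_
  cases m i
  · simp only [Bool.false_eq_true, if_false]; ring
  · simp only [if_true]; exact hH1 i

/-- **`E_m[Π_{i∈S} 𝟙[¬m_i]·c_i] = (1−ε)^{|S|}·Π_{i∈S} c_i`** for the mask `m ~ wt ε̄`: each coordinate survives the noise with probability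
`1 − ε`, independently. [cite: GarbanSteif2014, Ch. IV §1 (1.3) (the factor (1−ε)^{|S|})] -/
theorem sum_wt_mask_prod (ε : ℝ) (S : Finset ι) (c : ι → ℝ) :
    ∑ m : ι → Bool, wt (fun _ => ε) m * ∏ i ∈ S, (if m i = true then 0 else c i) = (1 - ε) ^ S.card * ∏ i ∈ S, c i := by
  rw [sum_wt_mul_prod_finset (fun _ => ε) S (fun i b => if b = true then 0 else c i)]
  simp only [if_true, Bool.false_eq_true, if_false, mul_zero, zero_add]
  rw [Finset.prod_mul_distrib, Finset.prod_const]

/-- **THE NOISE OPERATOR IS DIAGONAL**: the `S`-coefficient of `T_ε f (x) = E_{y,m} f(ω^ε)` is `(1 − ε)^{|S|}·f̂(S)`.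
[cite: GarbanSteif2014, Ch. IV §1 (1.3) and §IV.1 (p-biased)] [cite: ODonnell2014, §2.4 Prop 2.47 / §8.4 (T_ρ on the p-biased cube)] -/
theorem noise_coeff {p : ι → ℝ} {r : ι → Bool → ℝ} (hH1 : ∀ i, p i * r i true + (1 - p i) * r i false = 0)
    (f : (ι → Bool) → ℝ) (ε : ℝ) (S : Finset ι) :
    ∑ x : ι → Bool, wt p x * ((∑ y : ι → Bool, ∑ m : ι → Bool, wt p y * wt (fun _ => ε) m * f (fun i => if m i = true then y i else x i))
        * ∏ i ∈ S, r i (x i))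
      = (1 - ε) ^ S.card * ∑ x : ι → Bool, wt p x * (f x * ∏ i ∈ S, r i (x i)) := by
  -- bring the mask sum outside
  calc ∑ x : ι → Bool, wt p x * ((∑ y : ι → Bool, ∑ m : ι → Bool, wt p y * wt (fun _ => ε) m
          * f (fun i => if m i = true then y i else x i)) * ∏ i ∈ S, r i (x i))
      = ∑ x : ι → Bool, ∑ y : ι → Bool, ∑ m : ι → Bool, wt (fun _ => ε) m * (wt p x * wt p y *
          (f (fun i => if m i = true then y i else x i) * ∏ i ∈ S, r i (x i))) := by
        refine Finset.sum_congr rfl fun x _ => ?_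
        simp only [Finset.sum_mul, Finset.mul_sum]
        exact Finset.sum_congr rfl fun y _ => Finset.sum_congr rfl fun m _ => by ring
    _ = ∑ m : ι → Bool, wt (fun _ => ε) m * ∑ x : ι → Bool, ∑ y : ι → Bool, wt p x * wt p y *
          (f (fun i => if m i = true then y i else x i) * ∏ i ∈ S, r i (x i)) := by
        rw [Finset.sum_congr rfl (fun x (_ : x ∈ (Finset.univ : Finset (ι → Bool))) => Finset.sum_comm), Finset.sum_comm]
        simp only [Finset.mul_sum]
    _ = ∑ m : ι → Bool, wt (fun _ => ε) m * ∑ x : ι → Bool, ∑ y : ι → Bool, wt p x * wt p y *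
          (f x * ∏ i ∈ S, r i (if m i = true then y i else x i)) := by
        refine Finset.sum_congr rfl fun m _ => ?_
        congr 1
        rw [sum_sum_wt_mask_swap p m]
        refine Finset.sum_congr rfl fun x _ => Finset.sum_congr rfl fun y _ => ?_
        congr 2
        · congr 1; funext i; by_cases hm : m i = true <;> simp [hm]
    _ = ∑ m : ι → Bool, wt (fun _ => ε) m * ∑ x : ι → Bool, wt p x * (f x * ∏ i ∈ S, (if m i = true then 0 else r i (x i))) := by
        refine Finset.sum_congr rfl fun m _ => ?_
        congr 1
        refine Finset.sum_congr rfl fun x _ => ?_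
        rw [← sum_wt_char_mask hH1 S m x, Finset.mul_sum, Finset.mul_sum]
        exact Finset.sum_congr rfl fun y _ => by ring
    _ = ∑ x : ι → Bool, wt p x * (f x * ∑ m : ι → Bool, wt (fun _ => ε) m * ∏ i ∈ S, (if m i = true then 0 else r i (x i))) := by
        simp only [Finset.mul_sum]
        rw [Finset.sum_comm]
        exact Finset.sum_congr rfl fun x _ => Finset.sum_congr rfl fun m _ => by ring
    _ = (1 - ε) ^ S.card * ∑ x : ι → Bool, wt p x * (f x * ∏ i ∈ S, r i (x i)) := by
        rw [Finset.mul_sum]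
        refine Finset.sum_congr rfl fun x _ => ?_
        rw [sum_wt_mask_prod ε S (fun i => r i (x i))]
        ring

/-- **THE SPECTRAL FORMULA FOR THE NOISE CORRELATION**: `E[f(ω)·f(ω^ε)] = Σ_S (1 − ε)^{|S|}·f̂(S)²` (Plancherel with the diagonal noise
operator), every `p ∈ [0,1]^ι`, every character system. [cite: SchrammSteif2010, §1 (E[f(ω)f(ω_ε)] = Σ_S f̂(S)²(1−ε)^{|S|})]
[cite: GarbanSteif2014, Ch. IV (1.3)–(1.4)] -/
theorem noise_correlation_eq_sum_coeff_sq {p : ι → ℝ} {r : ι → Bool → ℝ} (hH1 : ∀ i, p i * r i true + (1 - p i) * r i false = 0)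
    (hH2 : ∀ i (b b' : Bool), coordWt p i b ≠ 0 → coordWt p i b' * (1 + r i b * r i b') = if b' = b then 1 else 0)
    (f : (ι → Bool) → ℝ) (ε : ℝ) :
    ∑ x : ι → Bool, ∑ y : ι → Bool, ∑ m : ι → Bool, wt p x * wt p y * wt (fun _ => ε) m
        * (f x * f (fun i => if m i = true then y i else x i))
      = ∑ S ∈ (Finset.univ : Finset ι).powerset, (1 - ε) ^ S.card * (∑ x : ι → Bool, wt p x * (f x * ∏ i ∈ S, r i (x i))) ^ 2 := by
  calc ∑ x : ι → Bool, ∑ y : ι → Bool, ∑ m : ι → Bool, wt p x * wt p y * wt (fun _ => ε) m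
          * (f x * f (fun i => if m i = true then y i else x i))
      = ∑ x : ι → Bool, wt p x * (f x * ∑ y : ι → Bool, ∑ m : ι → Bool, wt p y * wt (fun _ => ε) m
          * f (fun i => if m i = true then y i else x i)) := by
        refine Finset.sum_congr rfl fun x _ => ?_
        simp only [Finset.mul_sum]
        exact Finset.sum_congr rfl fun y _ => Finset.sum_congr rfl fun m _ => by ring
    _ = ∑ S ∈ (Finset.univ : Finset ι).powerset, (∑ x : ι → Bool, wt p x * (f x * ∏ i ∈ S, r i (x i)))
          * ∑ x : ι → Bool, wt p x * ((∑ y : ι → Bool, ∑ m : ι → Bool, wt p y * wt (fun _ => ε) m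
              * f (fun i => if m i = true then y i else x i)) * ∏ i ∈ S, r i (x i)) :=
        sum_wt_mul_mul_eq_sum_coeff hH2 f _
    _ = ∑ S ∈ (Finset.univ : Finset ι).powerset, (1 - ε) ^ S.card * (∑ x : ι → Bool, wt p x * (f x * ∏ i ∈ S, r i (x i))) ^ 2 := by
        refine Finset.sum_congr rfl fun S _ => ?_
        rw [noise_coeff hH1 f ε S]
        ring

/-- `f̂(∅) = E_p[f]` (`χ_∅ = 1`). [cite: ODonnell2014, §8.4 (f̂(∅) = E[f])] -/
theorem coeff_empty (p : ι → ℝ) (r : ι → Bool → ℝ) (f : (ι → Bool) → ℝ) :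
    ∑ x : ι → Bool, wt p x * (f x * ∏ i ∈ (∅ : Finset ι), r i (x i)) = ∑ x : ι → Bool, wt p x * f x := by
  simp

/-! ## §2 Noise correlation against the low-level Fourier weight -/

section Levels

variable {p : ι → ℝ} (h0 : ∀ i, 0 ≤ p i) (h1 : ∀ i, p i ≤ 1) {r : ι → Bool → ℝ}
  (hH1 : ∀ i, p i * r i true + (1 - p i) * r i false = 0)
  (hH2 : ∀ i (b b' : Bool), coordWt p i b ≠ 0 → coordWt p i b' * (1 + r i b * r i b') = if b' = b then 1 else 0)

include hH1 hH2 in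
/-- **NOISE CORRELATION EXCEEDS THE SQUARED MEAN**: `0 ≤ E[f(ω)f(ω^ε)] − E[f]²` for `ε ≤ 1` (all terms `(1−ε)^{|S|} f̂(S)²`, `S ≠ ∅`, are `≥ 0`).
[cite: GarbanSteif2014, Ch. IV (1.4) (E[f(ω)f(ω_ε)] − E[f]² = Σ_{S≠∅}(1−ε)^{|S|} f̂(S)² ≥ 0)] -/
theorem noise_correlation_sub_sq_nonneg (f : (ι → Bool) → ℝ) {ε : ℝ} (hε1 : ε ≤ 1) :
    0 ≤ (∑ x : ι → Bool, ∑ y : ι → Bool, ∑ m : ι → Bool, wt p x * wt p y * wt (fun _ => ε) m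
        * (f x * f (fun i => if m i = true then y i else x i))) - (∑ x : ι → Bool, wt p x * f x) ^ 2 := by
  rw [noise_correlation_eq_sum_coeff_sq hH1 hH2 f ε,
    ← Finset.add_sum_erase _ _ (Finset.empty_mem_powerset (Finset.univ : Finset ι))]
  simp only [Finset.card_empty, pow_zero, one_mul, Finset.prod_empty, mul_one]
  have : 0 ≤ ∑ S ∈ (Finset.univ : Finset ι).powerset.erase ∅, (1 - ε) ^ S.card * (∑ x : ι → Bool, wt p x * (f x * ∏ i ∈ S, r i (x i))) ^ 2 :=
    Finset.sum_nonneg fun S _ => mul_nonneg (pow_nonneg (by linarith) _) (sq_nonneg _)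
  linarith

include hH1 hH2 in
/-- **NOISE CORRELATION AGAINST THE LOW LEVELS**: for `0 ≤ ε ≤ 1` and every `m`,
`E[f(ω)f(ω^ε)] − E[f]² ≤ Σ_{k=1}^{m} Σ_{|S|=k} f̂(S)² + (1−ε)^{m+1}·(E[f²] − E[f]²)`
(`(1−ε)^{|S|} ≤ 1` on the levels `1..m`, `≤ (1−ε)^{m+1}` above; Parseval for the tail).
[cite: GarbanSteif2014, Ch. IV (1.4) and Ch. I Prop I.4/VIII.3 (noise sensitivity from the spectrum)] -/
theorem noise_correlation_sub_sq_le (f : (ι → Bool) → ℝ) {ε : ℝ} (hε0 : 0 ≤ ε) (hε1 : ε ≤ 1) (m : ℕ) :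
    (∑ x : ι → Bool, ∑ y : ι → Bool, ∑ m : ι → Bool, wt p x * wt p y * wt (fun _ => ε) m
        * (f x * f (fun i => if m i = true then y i else x i))) - (∑ x : ι → Bool, wt p x * f x) ^ 2
      ≤ (∑ k ∈ Finset.Icc 1 m, ∑ S ∈ (Finset.univ : Finset ι).powersetCard k, (∑ x : ι → Bool, wt p x * (f x * ∏ i ∈ S, r i (x i))) ^ 2)
        + (1 - ε) ^ (m + 1) * ((∑ x : ι → Bool, wt p x * (f x * f x)) - (∑ x : ι → Bool, wt p x * f x) ^ 2) := by
  -- abbreviations: squared coefficients `c S ≥ 0`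
  obtain ⟨c, hc⟩ : ∃ c : Finset ι → ℝ, c = fun S => (∑ x : ι → Bool, wt p x * (f x * ∏ i ∈ S, r i (x i))) ^ 2 := ⟨_, rfl⟩
  have hc0 : ∀ S, 0 ≤ c S := fun S => by rw [hc]; exact sq_nonneg _
  have h1ε : 0 ≤ 1 - ε := by linarith
  have h1ε' : 1 - ε ≤ 1 := by linarith
  -- the three quantities through `c`
  have hC : (∑ x : ι → Bool, ∑ y : ι → Bool, ∑ m : ι → Bool, wt p x * wt p y * wt (fun _ => ε) m
        * (f x * f (fun i => if m i = true then y i else x i)))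
      = ∑ S ∈ (Finset.univ : Finset ι).powerset, (1 - ε) ^ S.card * c S := by
    rw [noise_correlation_eq_sum_coeff_sq hH1 hH2 f ε, hc]
  have hE : (∑ x : ι → Bool, wt p x * f x) ^ 2 = c ∅ := by rw [hc]; simp
  have hP : ∑ x : ι → Bool, wt p x * (f x * f x) = ∑ S ∈ (Finset.univ : Finset ι).powerset, c S := by
    rw [sum_wt_mul_sq_eq_sum_coeff_sq hH2 f, hc]
  have hL : (∑ k ∈ Finset.Icc 1 m, ∑ S ∈ (Finset.univ : Finset ι).powersetCard k, (∑ x : ι → Bool, wt p x * (f x * ∏ i ∈ S, r i (x i))) ^ 2)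
      = ∑ k ∈ Finset.Icc 1 m, ∑ S ∈ (Finset.univ : Finset ι).powersetCard k, c S := by rw [hc]
  rw [hC, hE, hP, hL]
  -- remove the empty set
  set P : Finset (Finset ι) := (Finset.univ : Finset ι).powerset with hPdef
  have h0P : (∅ : Finset ι) ∈ P := Finset.empty_mem_powerset _
  rw [← Finset.add_sum_erase _ _ h0P, ← Finset.add_sum_erase P c h0P]
  simp only [Finset.card_empty, pow_zero, one_mul, add_sub_cancel_left]
  -- termwise bound on `P.erase ∅`
  have hterm : ∀ S ∈ P.erase ∅, (1 - ε) ^ S.card * c S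
      ≤ (if S.card ≤ m then c S else 0) + (1 - ε) ^ (m + 1) * c S := by
    intro S hS
    have hS0 : S ≠ ∅ := Finset.ne_of_mem_erase hS
    have hcard1 : 1 ≤ S.card := Finset.card_pos.2 (Finset.nonempty_iff_ne_empty.2 hS0)
    split_ifs with hSm
    · have : (1 - ε) ^ S.card * c S ≤ 1 * c S := mul_le_mul_of_nonneg_right (pow_le_one₀ h1ε h1ε') (hc0 S)
      nlinarith [mul_nonneg (pow_nonneg h1ε (m + 1)) (hc0 S)]
    · have hle : (1 - ε) ^ S.card ≤ (1 - ε) ^ (m + 1) := pow_le_pow_of_le_one h1ε h1ε' (by omega)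
      nlinarith [mul_le_mul_of_nonneg_right hle (hc0 S)]
  refine (Finset.sum_le_sum hterm).trans ?_
  rw [Finset.sum_add_distrib, ← Finset.mul_sum]
  refine add_le_add ?_ le_rfl
  -- the levels `1..m`: regroup the subsets by cardinality
  have hregroup : ∑ S ∈ P.erase ∅, (if S.card ≤ m then c S else 0)
      = ∑ k ∈ (Finset.range (Fintype.card ι + 1)).filter (fun k => 1 ≤ k ∧ k ≤ m),
          ∑ S ∈ (Finset.univ : Finset ι).powersetCard k, c S := by
    have h1 : ∑ S ∈ P.erase ∅, (if S.card ≤ m then c S else 0) = ∑ S ∈ P, (if 1 ≤ S.card ∧ S.card ≤ m then c S else 0) := by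
      rw [← Finset.add_sum_erase P _ h0P]
      simp only [Finset.card_empty, nonpos_iff_eq_zero, one_ne_zero, false_and, if_false, zero_add]
      refine Finset.sum_congr rfl fun S hS => ?_
      have hcard1 : 1 ≤ S.card := Finset.card_pos.2 (Finset.nonempty_iff_ne_empty.2 (Finset.ne_of_mem_erase hS))
      simp [hcard1]
    rw [h1, hPdef, Finset.sum_powerset, Finset.card_univ, Finset.sum_filter]
    refine Finset.sum_congr rfl fun k _ => ?_
    split_ifs with hk
    · exact Finset.sum_congr rfl fun S hS => by rw [(Finset.mem_powersetCard.1 hS).2, if_pos hk]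
    · exact Finset.sum_eq_zero fun S hS => by rw [(Finset.mem_powersetCard.1 hS).2, if_neg hk]
  rw [hregroup]
  -- compare index sets: `{k ≤ card ι : 1 ≤ k ≤ m} ⊆ Icc 1 m`, the summands are `≥ 0`
  refine Finset.sum_le_sum_of_subset_of_nonneg ?_ (fun k _ _ => Finset.sum_nonneg fun S _ => hc0 S)
  intro k hk
  simp only [Finset.mem_filter, Finset.mem_range] at hk
  exact Finset.mem_Icc.2 hk.2

end Levels

/-! ## §3 Noise sensitivity from small revealment -/

/-- **NOISE SENSITIVITY FROM SMALL REVEALMENT** (Schramm–Steif): on the p-biased cube `ι → Bool`, `p ∈ [0,1]^ι`, let `f` be computed by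
the reduced decision trees `T_t` mixed with probability weights `q_t`, every coordinate being revealed with probability `Σ_t q_t P_p(i ∈ J_t) ≤ δ`.
Then for every noise level `0 ≤ ε ≤ 1` and EVERY `m : ℕ`:
**`0 ≤ E_p[f(ω)·f(ω^ε)] − E_p[f]² ≤ m²·δ·E_p[f²] + (1 − ε)^{m+1}·(E_p[f²] − E_p[f]²)`**,
`ω^ε` = each coordinate independently resampled from its bias with probability `ε`.  (Statement free of Fourier analysis; the p-biased
character system of part I is used inside.)  For indicators, `E f² = P ≤ 1`: the correlation of `𝟙_A(ω)` and `𝟙_A(ω^ε)` is at most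
`m²δ + (1−ε)^{m+1}` above `P²`.
[cite: SchrammSteif2010, Thm 1.8 and Cor 1.9 (noise sensitivity from revealment → 0)] [cite: GarbanSteif2014, Ch. VIII Thm VIII.1, Prop VIII.3]
[cite: BenjaminiKalaiSchramm1999, §1 (1.2) (definition of noise sensitivity)] -/
theorem noise_correlation_sub_sq_le_of_revealment (p : ι → ℝ) (h0 : ∀ i, 0 ≤ p i) (h1 : ∀ i, p i ≤ 1)
    (f : (ι → Bool) → ℝ) {τ : Type*} [Fintype τ] (q : τ → ℝ) (hq0 : ∀ t, 0 ≤ q t) (hq1 : ∑ t, q t = 1)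
    (T : τ → DecTree ι) (hT : ∀ t, (T t).Reduced) (hf : ∀ t x, (T t).eval x = f x) {δ : ℝ} (hδ0 : 0 ≤ δ)
    (hδ : ∀ i, ∑ t, q t * ∑ x : ι → Bool, wt p x * (if i ∈ (T t).queried x then (1 : ℝ) else 0) ≤ δ)
    {ε : ℝ} (hε0 : 0 ≤ ε) (hε1 : ε ≤ 1) (m : ℕ) :
    0 ≤ (∑ x : ι → Bool, ∑ y : ι → Bool, ∑ m : ι → Bool, wt p x * wt p y * wt (fun _ => ε) m
          * (f x * f (fun i => if m i = true then y i else x i))) - (∑ x : ι → Bool, wt p x * f x) ^ 2 ∧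
      (∑ x : ι → Bool, ∑ y : ι → Bool, ∑ m : ι → Bool, wt p x * wt p y * wt (fun _ => ε) m
          * (f x * f (fun i => if m i = true then y i else x i))) - (∑ x : ι → Bool, wt p x * f x) ^ 2
        ≤ (m : ℝ) ^ 2 * δ * (∑ x : ι → Bool, wt p x * (f x * f x))
          + (1 - ε) ^ (m + 1) * ((∑ x : ι → Bool, wt p x * (f x * f x)) - (∑ x : ι → Bool, wt p x * f x) ^ 2) := by
  -- the p-biased character system
  have hH1 := pbiased_H1 p
  have hH2 := pbiased_H2 p h0 h1
  refine ⟨noise_correlation_sub_sq_nonneg hH1 hH2 f hε1, ?_⟩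
  refine (noise_correlation_sub_sq_le hH1 hH2 f hε0 hε1 m).trans ?_
  exact add_le_add (low_level_weight_le_revealment p h0 h1 hH1 hH2 f q hq0 hq1 T hT hf m hδ0 hδ) le_rfl

end Summit.CriticalPhenomena.PercolationContinuityZ3.Theorems.Crossing.Spectral

end
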